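import Literature.Probability.RandomPlanarGeometry.HexSAWBrickWallStrip
import Mathlib.Analysis.SpecialFunctions.Pow.Real
import Mathlib.Analysis.SpecialFunctions.Pow.Continuity
import Mathlib.Analysis.SpecificLimits.Normed
import HarnessLib

/-!
# The margin-extraction engine for strict strip inequalities, and its honeycomb instances

Topic `Literature/Probability/RandomPlanarGeometry` (continues `SAWStripInsertionMargin.lean` — the lane's `ℤ²` strict
strip inequalities WITH MARGIN by column insertion, whose analytic half (`extract`: "if
`μ(S_L)ⁿ xⁿ (1 + x^{2L+4})^{⌊n/(L+1)⌋} ≤ B Σ_{m ≤ Kn} C_m x^m` for `0 < x ≤ 1` then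
`log(1 + γ^{-(2L+4)})/(L+1) ≤ log γ − log μ(S_L)`") is private there — and `HexSAWBrickWallStrip.lean` — the row strips
`S_T` of the brick wall = honeycomb lattice, `HexBW.stripCount T n = c_n(S_T)`, `HexBW.stripConnectiveConstant T = μ(S_T)`).
Source of the printed statements: N. Madras, G. Slade, *The Self-Avoiding Walk* (1993), §8.2, Theorem 8.2.1, p. 269:
"(8.2.11) `μ(R) < μ` … (8.2.13) `μ(R[k,T]) < μ(R[k,T+1])`" (no margin printed; for honeycomb strips the strict
inequality is Beaton–Bousquet-Mélou–de Gier–Duminil-Copin–Guttmann 2014, Proposition 7 at `y = 1`, also without margin).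

## What is here (lane «pcv-sawmu», door «HEX-STRIP-STRICT» of a-idea-1 g16, ROUTES-G16 §2: face H5, the analytic half)

* `SAW.MarginExtraction.log_margin_of_core` — the extraction lemma, PUBLIC and lattice-free (proof = the tree's);
* `HexBW.pow_stripConnectiveConstant_le_stripCount` — `μ(S_T)ⁿ ≤ c_n(S_T)` ((8.2.3));
* **`HexBW.log_stripConnectiveConstant_succ_sub_log_ge_of_core`** — GIVEN the summed finite core of an insertion
  `c_n(S_T) xⁿ (1 + x^{4T+8})^{⌊n/(2(T+1))⌋} ≤ B Σ_{m ≤ Kn} c_m(S_{T+1}) x^m` (`0 < x ≤ 1`; the shape the 4-column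
  insertion of ROUTES-G16 §2.3 is designed to deliver: cost `≤ 4T+8` per cut, `⌊n/(2(T+1))⌋` admissible cuts), the
  margin `log(1 + μ(S_{T+1})^{-(4T+8)})/(2(T+1)) ≤ log μ(S_{T+1}) − log μ(S_T)` — i.e. a-idea-1's face
  `HexBW.StripStrictMargin T` (Sketch_G16_HexStripStrict) — follows BY NAME; and the `μ_ℍ` twin
  **`HexBW.log_hexConnectiveConstant_sub_log_stripConnectiveConstant_ge_of_core`** with `c_m(ℍ)` on the right.

The combinatorial core (the insertion, its injectivity and the cut density: faces H1–H4) is NOT here.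
-/

noncomputable section

open Filter Topology Finset Literature.Probability.LatticeModels Literature.Probability.Percolation

namespace Literature.Probability.RandomPlanarGeometry.SAW

namespace MarginExtraction

/-- For `0 < x < 1/γ` and `C_m^{1/m} → γ`, the sequence `C_m x^m` is bounded. [folklore] -/
private theorem exists_bound_of_tendsto_rpow {C : ℕ → ℝ} {γ x : ℝ} (hC0 : ∀ m, 0 ≤ C m)
    (hC : Tendsto (fun m : ℕ => C m ^ (1 / (m : ℝ))) atTop (𝓝 γ)) (hγ : 0 < γ) (hx : 0 < x)
    (hxγ : x < 1 / γ) : ∃ K : ℝ, 0 ≤ K ∧ ∀ m, C m * x ^ m ≤ K := by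
  set u : ℝ := (γ + x⁻¹) / 2 with hu
  have hxinv : γ < x⁻¹ := by
    have := (lt_one_div hx hγ).1 hxγ; rwa [one_div] at this
  have hγu : γ < u := by rw [hu]; linarith
  have hux : u * x ≤ 1 := by
    have : u < x⁻¹ := by rw [hu]; linarith
    have h1 : u * x < x⁻¹ * x := mul_lt_mul_of_pos_right this hx
    rw [inv_mul_cancel₀ hx.ne'] at h1
    exact h1.le
  have hu0 : 0 ≤ u := by rw [hu]; positivity
  have hev : ∀ᶠ m : ℕ in atTop, C m * x ^ m ≤ 1 := by
    filter_upwards [hC.eventually_lt_const hγu, eventually_ge_atTop 1] with m hm hm1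
    have hm0 : (m : ℕ) ≠ 0 := by omega
    have h1 : C m = (C m ^ (1 / (m : ℝ))) ^ m := by
      rw [one_div, Real.rpow_inv_natCast_pow (hC0 m) hm0]
    have h2 : C m ≤ u ^ m := by
      rw [h1]; exact pow_le_pow_left₀ (Real.rpow_nonneg (hC0 m) _) hm.le m
    calc C m * x ^ m ≤ u ^ m * x ^ m := mul_le_mul_of_nonneg_right h2 (pow_nonneg hx.le m)
      _ = (u * x) ^ m := (mul_pow u x m).symm
      _ ≤ 1 := pow_le_one₀ (mul_nonneg hu0 hx.le) hux
  obtain ⟨N, hN⟩ := eventually_atTop.1 hev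
  refine ⟨1 + ∑ m ∈ Finset.range N, C m * x ^ m, ?_, fun m => ?_⟩
  · have : 0 ≤ ∑ m ∈ Finset.range N, C m * x ^ m :=
      Finset.sum_nonneg fun m _ => mul_nonneg (hC0 m) (pow_nonneg hx.le m)
    linarith
  · rcases lt_or_ge m N with h | h
    · have : C m * x ^ m ≤ ∑ m ∈ Finset.range N, C m * x ^ m :=
        Finset.single_le_sum (f := fun m => C m * x ^ m)
          (fun m _ => mul_nonneg (hC0 m) (pow_nonneg hx.le m)) (Finset.mem_range.2 h)
      linarith
    · have : 0 ≤ ∑ m ∈ Finset.range N, C m * x ^ m :=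
        Finset.sum_nonneg fun m _ => mul_nonneg (hC0 m) (pow_nonneg hx.le m)
      linarith [hN m h]

/-- Exponential versus linear growth: if `yⁿ ≤ D·n` for all `n ≥ 1` then `y ≤ 1`. [folklore] -/
private theorem le_one_of_pow_le_mul {y D : ℝ} (hD : 0 ≤ D) (h : ∀ n : ℕ, 1 ≤ n → y ^ n ≤ D * n) :
    y ≤ 1 := by
  by_contra hy1
  rw [not_le] at hy1
  have ht := tendsto_pow_const_div_const_pow_of_one_lt 1 hy1
  have hev := ht.eventually_lt_const (show (0 : ℝ) < 1 / (D + 1) by positivity)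
  obtain ⟨N, hN⟩ := eventually_atTop.1 hev
  have hN1 := hN (N + 1) (by omega)
  have hn := h (N + 1) (by omega)
  have hpow : 0 < y ^ (N + 1) := pow_pos (by linarith) _
  simp only [pow_one] at hN1
  -- `1 ≤ D (N+1) / y^{N+1} < D/(D+1) < 1`
  have h1 : 1 ≤ D * (((N + 1 : ℕ) : ℝ) / y ^ (N + 1)) := by
    rw [mul_div_assoc', le_div_iff₀ hpow, one_mul]; exact hn
  have h2 : D * (((N + 1 : ℕ) : ℝ) / y ^ (N + 1)) ≤ D * (1 / (D + 1)) :=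
    mul_le_mul_of_nonneg_left hN1.le hD
  have h3 : D * (1 / (D + 1)) < 1 := by
    rw [mul_one_div, div_lt_one (by linarith)]; linarith
  linarith

/-- `n/(L+1) ≤ ⌊n/(L+1)⌋ + 1` between real and natural division. [folklore] -/
private theorem div_le_natDiv_add_one (n L : ℕ) : (n : ℝ) / ((L : ℝ) + 1) ≤ ((n / (L + 1) : ℕ) : ℝ) + 1 := by
  have h := Nat.lt_div_mul_add (a := n) (b := L + 1) (by omega)
  rw [div_le_iff₀ (by positivity)]
  have : (n : ℝ) ≤ ((n / (L + 1) : ℕ) : ℝ) * ((L : ℝ) + 1) + ((L : ℝ) + 1) := by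
    exact_mod_cast h.le
  linarith

/-- **Extraction lemma (the analytic half of every "insertion ⇒ margin" argument).** If
`αⁿ xⁿ (1 + x^E)^{⌊n/(L+1)⌋} ≤ B Σ_{m ≤ Kn} C_m x^m` for all `n` and all `0 < x ≤ 1`, where `C_m^{1/m} → γ ≥ 1`, then
`log(1 + γ^{-E})/(L+1) ≤ log γ − log α` (exponential versus linear growth below `1/γ`, then `x ↑ 1/γ` by continuity).
This is the tree's `Zd.StripInsertion.extract` (PRIVATE in `SAWStripInsertionMargin.lean`, lane item X16) made public and
lattice-free; proof verbatim. [cite: MadrasSlade1993, §8.2, Theorem 8.2.1 (8.2.11)/(8.2.13) (quantitative forms: the lane's column insertion)] -/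
theorem log_margin_of_core {α γ B : ℝ} {E L K : ℕ} {C : ℕ → ℝ} (hα : 0 < α) (hγ : 1 ≤ γ) (hB : 0 ≤ B)
    (hC0 : ∀ m, 0 ≤ C m) (hC : Tendsto (fun m : ℕ => C m ^ (1 / (m : ℝ))) atTop (𝓝 γ))
    (h : ∀ n : ℕ, ∀ x : ℝ, 0 < x → x ≤ 1 →
      α ^ n * x ^ n * (1 + x ^ E) ^ (n / (L + 1)) ≤
        B * ∑ m ∈ Finset.range (K * n + 1), C m * x ^ m) :
    Real.log (1 + γ ^ (-(E : ℝ))) / ((L : ℝ) + 1) ≤ Real.log γ - Real.log α := by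
  have hγ0 : 0 < γ := by linarith
  set r : ℝ := 1 / ((L : ℝ) + 1) with hr
  have hr0 : 0 ≤ r := by rw [hr]; positivity
  set g : ℝ → ℝ := fun x => α * x * (1 + x ^ E) ^ r with hg
  -- Step B: `g x ≤ 1` for `0 ≤ x < 1/γ`
  have hB' : ∀ x : ℝ, 0 ≤ x → x < 1 / γ → g x ≤ 1 := by
    intro x hx0 hxγ
    rcases hx0.eq_or_lt with rfl | hx
    · simp [hg]
    have hx1 : x ≤ 1 := by
      have : 1 / γ ≤ 1 := by rw [div_le_one hγ0]; exact hγ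
      linarith
    obtain ⟨Kx, hKx0, hKx⟩ := exists_bound_of_tendsto_rpow hC0 hC hγ0 hx hxγ
    have hb1 : 1 ≤ 1 + x ^ E := by linarith [pow_nonneg hx.le E]
    have hgx : g x = α * x * (1 + x ^ E) ^ r := rfl
    refine le_one_of_pow_le_mul
      (show 0 ≤ (1 + x ^ E) * B * Kx * ((K : ℝ) + 1) by positivity) fun n hn => ?_
    -- `g(x)^n = αⁿ xⁿ (1+x^E)^{rn} ≤ αⁿ xⁿ (1+x^E)^{⌊n/(L+1)⌋} (1+x^E)`
    have e1 : g x ^ n = α ^ n * x ^ n * (1 + x ^ E) ^ (r * n) := by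
      rw [hgx, mul_pow, mul_pow, Real.rpow_mul (by linarith), Real.rpow_natCast]
    have e2 : (1 + x ^ E) ^ (r * n) ≤ (1 + x ^ E) ^ (n / (L + 1)) * (1 + x ^ E) := by
      rw [← Real.rpow_natCast (1 + x ^ E) (n / (L + 1)), ← Real.rpow_add_one (by linarith)]
      refine Real.rpow_le_rpow_of_exponent_le hb1 ?_
      rw [hr, one_div_mul_eq_div]
      exact div_le_natDiv_add_one n L
    have e3 : ∑ m ∈ Finset.range (K * n + 1), C m * x ^ m ≤ ((K * n + 1 : ℕ) : ℝ) * Kx := by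
      calc ∑ m ∈ Finset.range (K * n + 1), C m * x ^ m ≤ ∑ _m ∈ Finset.range (K * n + 1), Kx :=
            Finset.sum_le_sum fun m _ => hKx m
        _ = _ := by rw [Finset.sum_const, Finset.card_range, nsmul_eq_mul]
    have e4 : ((K * n + 1 : ℕ) : ℝ) ≤ ((K : ℝ) + 1) * n := by
      push_cast
      have : (1 : ℝ) ≤ n := by exact_mod_cast hn
      nlinarith
    have hmain := h n x hx hx1
    calc g x ^ n = α ^ n * x ^ n * (1 + x ^ E) ^ (r * n) := e1
      _ ≤ α ^ n * x ^ n * ((1 + x ^ E) ^ (n / (L + 1)) * (1 + x ^ E)) :=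
          mul_le_mul_of_nonneg_left e2 (by positivity)
      _ = (α ^ n * x ^ n * (1 + x ^ E) ^ (n / (L + 1))) * (1 + x ^ E) := by ring
      _ ≤ (B * ∑ m ∈ Finset.range (K * n + 1), C m * x ^ m) * (1 + x ^ E) :=
          mul_le_mul_of_nonneg_right hmain (by linarith)
      _ ≤ (B * (((K * n + 1 : ℕ) : ℝ) * Kx)) * (1 + x ^ E) :=
          mul_le_mul_of_nonneg_right (mul_le_mul_of_nonneg_left e3 hB) (by linarith)
      _ ≤ (B * ((((K : ℝ) + 1) * n) * Kx)) * (1 + x ^ E) :=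
          mul_le_mul_of_nonneg_right (mul_le_mul_of_nonneg_left
            (mul_le_mul_of_nonneg_right e4 hKx0) hB) (by linarith)
      _ = (1 + x ^ E) * B * Kx * ((K : ℝ) + 1) * n := by ring
  -- Step C: continuity at `x₀ = 1/γ`
  have hcont : Continuous g := by
    rw [hg]
    exact (continuous_const.mul continuous_id).mul
      ((continuous_const.add (continuous_pow E)).rpow_const fun x => Or.inr hr0)
  set xs : ℕ → ℝ := fun k => (1 / γ) * (1 - 1 / ((k : ℝ) + 1)) with hxs
  have hxs_lim : Tendsto xs atTop (𝓝 (1 / γ)) := by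
    have h1 : Tendsto (fun k : ℕ => (1 : ℝ) - 1 / ((k : ℝ) + 1)) atTop (𝓝 (1 - 0)) :=
      tendsto_const_nhds.sub tendsto_one_div_add_atTop_nhds_zero_nat
    have h2 := h1.const_mul (1 / γ)
    rw [sub_zero, mul_one] at h2
    exact h2
  have hgx0 : g (1 / γ) ≤ 1 := by
    refine le_of_tendsto' ((hcont.tendsto _).comp hxs_lim) fun k => hB' (xs k) ?_ ?_
    · rw [hxs]
      have : (0 : ℝ) ≤ 1 - 1 / ((k : ℝ) + 1) := by
        rw [sub_nonneg, div_le_one (by positivity)]; linarith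
      positivity
    · rw [hxs]
      have h1 : (0 : ℝ) < 1 / ((k : ℝ) + 1) := by positivity
      have h2 : 0 < 1 / γ := by positivity
      nlinarith
  -- Step D: logarithms
  have hb : 0 < 1 + γ ^ (-(E : ℝ)) := by positivity
  have hval : g (1 / γ) = α * γ⁻¹ * (1 + γ ^ (-(E : ℝ))) ^ r := by
    rw [hg]; simp only
    rw [one_div, Real.rpow_neg hγ0.le, Real.rpow_natCast, inv_pow]
  rw [hval] at hgx0
  have hpos : 0 < α * γ⁻¹ * (1 + γ ^ (-(E : ℝ))) ^ r := by positivity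
  have hlog := Real.log_nonpos hpos.le hgx0
  rw [Real.log_mul (by positivity) (by positivity), Real.log_mul hα.ne' (by positivity),
    Real.log_inv, Real.log_rpow hb, hr, one_div_mul_eq_div] at hlog
  linarith

end MarginExtraction

namespace HexBW

open MarginExtraction

/-- `μ(S_T)ⁿ ≤ c_n(S_T)` for every `n` ("`μ(R) = inf_{N ≥ 1} c_N(R)^{1/N}`", (8.2.3)), honeycomb row strips.
[cite: MadrasSlade1993, §8.2, eq. (8.2.3)] -/
theorem pow_stripConnectiveConstant_le_stripCount (T n : ℕ) :
    stripConnectiveConstant T ^ n ≤ (stripCount T n : ℝ) := by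
  rcases Nat.eq_zero_or_pos n with rfl | hn
  · rw [pow_zero]; exact_mod_cast one_le_stripCount T 0
  have h := stripConnectiveConstant_le_rpow T hn.ne'
  have hc : (0 : ℝ) ≤ stripCount T n := Nat.cast_nonneg _
  calc stripConnectiveConstant T ^ n ≤ ((stripCount T n : ℝ) ^ (1 / (n : ℝ))) ^ n :=
        pow_le_pow_left₀ (stripConnectiveConstant_pos T).le h n
    _ = stripCount T n := by rw [one_div, Real.rpow_inv_natCast_pow hc hn.ne']

/-- **Margin from the finite core, strip-to-strip** (face H5 of the door «HEX-STRIP-STRICT»): if an insertion gives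
`c_n(S_T) xⁿ (1 + x^{4T+8})^{⌊n/(2(T+1))⌋} ≤ B Σ_{m ≤ Kn} c_m(S_{T+1}) x^m` for all `n` and `0 < x ≤ 1`, then
`log(1 + μ(S_{T+1})^{-(4T+8)}) / (2(T+1)) ≤ log μ(S_{T+1}) − log μ(S_T)` — the quantitative form of (8.2.13) for
honeycomb strips (printed without margin: BBdGDCG 2014 Prop. 7 at `y = 1`).
[cite: MadrasSlade1993, §8.2, Theorem 8.2.1, eq. (8.2.13) (quantitative form, conditional on the insertion core)]
[cite: BeatonBousquetMelouDeGierDuminilCopinGuttmann2014, Proposition 7 (y = 1)] -/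
theorem log_stripConnectiveConstant_succ_sub_log_ge_of_core (T : ℕ) {B : ℝ} {K : ℕ} (hB : 0 ≤ B)
    (h : ∀ n : ℕ, ∀ x : ℝ, 0 < x → x ≤ 1 →
      (stripCount T n : ℝ) * x ^ n * (1 + x ^ (4 * T + 8)) ^ (n / (2 * (T + 1))) ≤
        B * ∑ m ∈ Finset.range (K * n + 1), (stripCount (T + 1) m : ℝ) * x ^ m) :
    Real.log (1 + stripConnectiveConstant (T + 1) ^ (-(4 * (T : ℝ) + 8))) / (2 * ((T : ℝ) + 1)) ≤
      Real.log (stripConnectiveConstant (T + 1)) - Real.log (stripConnectiveConstant T) := by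
  have hx := log_margin_of_core (E := 4 * T + 8) (L := 2 * T + 1) (K := K)
    (C := fun m => (stripCount (T + 1) m : ℝ)) (B := B) (stripConnectiveConstant_pos T)
    (one_le_stripConnectiveConstant (T + 1)) hB (fun m => Nat.cast_nonneg _) (tendsto_stripCount_rpow (T + 1))
    fun n x hx0 hx1 => by
      have e : n / (2 * T + 1 + 1) = n / (2 * (T + 1)) := by congr 1
      rw [e]
      exact (mul_le_mul_of_nonneg_right (mul_le_mul_of_nonneg_right
        (pow_stripConnectiveConstant_le_stripCount T n) (pow_nonneg hx0.le n))
        (pow_nonneg (by linarith [pow_nonneg hx0.le (4 * T + 8)]) _)).trans (h n x hx0 hx1)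
  have e1 : ((4 * T + 8 : ℕ) : ℝ) = 4 * (T : ℝ) + 8 := by push_cast; ring
  have e2 : ((2 * T + 1 : ℕ) : ℝ) + 1 = 2 * ((T : ℝ) + 1) := by push_cast; ring
  rwa [e1, e2] at hx

/-- **Margin from the finite core, strip-to-plane**: the same with `c_m(ℍ)` on the right gives
`log(1 + μ_ℍ^{-(4T+8)}) / (2(T+1)) ≤ log μ_ℍ − log μ(S_T)` — the quantitative form of (8.2.11) for honeycomb strips.
[cite: MadrasSlade1993, §8.2, Theorem 8.2.1, eq. (8.2.11) (quantitative form, conditional on the insertion core)] -/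
theorem log_hexConnectiveConstant_sub_log_stripConnectiveConstant_ge_of_core (T : ℕ) {B : ℝ} {K : ℕ} (hB : 0 ≤ B)
    (h : ∀ n : ℕ, ∀ x : ℝ, 0 < x → x ≤ 1 →
      (stripCount T n : ℝ) * x ^ n * (1 + x ^ (4 * T + 8)) ^ (n / (2 * (T + 1))) ≤
        B * ∑ m ∈ Finset.range (K * n + 1), (hexSawCount m : ℝ) * x ^ m) :
    Real.log (1 + hexConnectiveConstant ^ (-(4 * (T : ℝ) + 8))) / (2 * ((T : ℝ) + 1)) ≤
      Real.log hexConnectiveConstant - Real.log (stripConnectiveConstant T) := by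
  have hμ1 : 1 ≤ hexConnectiveConstant := (one_le_stripConnectiveConstant 0).trans (stripConnectiveConstant_le 0)
  have hx := log_margin_of_core (E := 4 * T + 8) (L := 2 * T + 1) (K := K)
    (C := fun m => (hexSawCount m : ℝ)) (B := B) (stripConnectiveConstant_pos T) hμ1 hB
    (fun m => Nat.cast_nonneg _) tendsto_hexSawCount_rpow
    fun n x hx0 hx1 => by
      have e : n / (2 * T + 1 + 1) = n / (2 * (T + 1)) := by congr 1
      rw [e]
      exact (mul_le_mul_of_nonneg_right (mul_le_mul_of_nonneg_right
        (pow_stripConnectiveConstant_le_stripCount T n) (pow_nonneg hx0.le n))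
        (pow_nonneg (by linarith [pow_nonneg hx0.le (4 * T + 8)]) _)).trans (h n x hx0 hx1)
  have e1 : ((4 * T + 8 : ℕ) : ℝ) = 4 * (T : ℝ) + 8 := by push_cast; ring
  have e2 : ((2 * T + 1 : ℕ) : ℝ) + 1 = 2 * ((T : ℝ) + 1) := by push_cast; ring
  rwa [e1, e2] at hx

/-- From the margin to the printed strict inequality `μ(S_T) < μ(S_{T+1})`, given the core.
[cite: BeatonBousquetMelouDeGierDuminilCopinGuttmann2014, Proposition 7 (y = 1)] [cite: MadrasSlade1993, §8.2, Theorem 8.2.1, eq. (8.2.13)] -/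
theorem stripConnectiveConstant_lt_succ_of_core (T : ℕ) {B : ℝ} {K : ℕ} (hB : 0 ≤ B)
    (h : ∀ n : ℕ, ∀ x : ℝ, 0 < x → x ≤ 1 →
      (stripCount T n : ℝ) * x ^ n * (1 + x ^ (4 * T + 8)) ^ (n / (2 * (T + 1))) ≤
        B * ∑ m ∈ Finset.range (K * n + 1), (stripCount (T + 1) m : ℝ) * x ^ m) :
    stripConnectiveConstant T < stripConnectiveConstant (T + 1) := by
  have hm := log_stripConnectiveConstant_succ_sub_log_ge_of_core T hB h
  have hμ := stripConnectiveConstant_pos (T + 1)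
  have hpos : 0 < Real.log (1 + stripConnectiveConstant (T + 1) ^ (-(4 * (T : ℝ) + 8))) / (2 * ((T : ℝ) + 1)) :=
    div_pos (Real.log_pos (by linarith [Real.rpow_pos_of_pos hμ (-(4 * (T : ℝ) + 8))])) (by positivity)
  have : Real.log (stripConnectiveConstant T) < Real.log (stripConnectiveConstant (T + 1)) := by linarith
  exact (Real.log_lt_log_iff (stripConnectiveConstant_pos T) hμ).1 this

end HexBW

end Literature.Probability.RandomPlanarGeometry.SAW
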